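import Literature.Probability.Percolation.FourArmGarbanMonotone
import Literature.Probability.Percolation.FourArmGarbanCircuitBits
import HarnessLib

/-!
# Docking inward arms to a circuit: the deterministic half of Garban's (B.4)

Topic `Literature/Probability/Percolation`; proof-only support file for the named fact
`Literature.Probability.Percolation.Garban2011_fourArm_multiscale` (`FourArmGarban.lean`;
C. Garban, Appendix B of O. Schramm, S. Smirnov, Ann. Probab. 39 (2011), Lemma B.1). Bond
percolation on `ℤ²`. No definition, no named fact.

Garban's conditional estimate (the display before (B.6)): "using the important fact that the event
`{C_j = 1}` is increasing [...], if `δ` is chosen small enough,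
`P[X = 1 | C_j = 1 and Q_j pivotal for X] > 1/2 + 1/8`" rests on a deterministic gluing: once the
two open arms landing on `∂Q_j` are continued inside `Q_j` down to the inner box `(1-2δ)Q_j`, the
open circuit of `S_j = (1-δ)Q_j ∖ (1-2δ)Q_j` (the event `O` of `C_j = 1_O - 1_Δ`) meets both
continuations, so the two arms are joined inside `Q_j` and `Q` is crossed (`X = 1`); dually for
`C_j = -1`. This file proves the gluing, in the form consumed by the docking predicates `F`, `F*`
of `le_integral_mul_bit_of_good` (`BlockConditioning.lean`):

* `exists_crossing_subwalk` — an open walk from outside `B(b')` into `B(a'-1)` contains an open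
  crossing of the annulus `A_{a',b'}` from `‖·‖_∞ = a'` to `‖·‖_∞ = b'` all of whose vertices lie
  on the walk (first-exit / last-entry surgery, `exists_prefix_exit`);
* `openConnIn_box_of_inward_walks_of_openCircuitInAnnulus` — **two inward open walks plus an open
  circuit give a connection**: if `ω` has an open circuit of `A_{a',b'}` around the origin
  (`openCircuitInAnnulus a' b'`) and open walks `P₁ : z₁ ⟶ u₁`, `P₂ : z₂ ⟶ u₂` inside `B(ρ)`
  (`b' ≤ ρ`) from sites `zᵢ ∉ B(b')` to sites `uᵢ ∈ B(a'-1)`, then `z₁ ↔ z₂` by an open path of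
  `B(ρ)` (`openConnIn`): each walk crosses `A_{a',b'}`, the enclosing circuit meets every crossing
  (`exists_mem_support_inter_of_enclosesOrigin`, `FourArmGarbanProofs.lean`), and the circuit
  joins the two meeting points;
* `openConnIn_box_of_inward_walks_of_dualCircuitInAnnulus` — the dual form (closed dual circuit of
  `S*`, the event `Δ`, and walks of dual vertices through dual edges crossing closed edges, i.e.
  walks open in `dualConfig ω`): the same statement for the configuration `dualConfig ω`.

With `zᵢ` the contact sites of the two outer open arms on `∂Q_j` (`ρ` = half-side of `Q_j`) the
first statement is "`F ∩ O ⇒` the open arms are joined through `Q_j`", with `zᵢ*` the contact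
faces of the dual arms the second is "`F* ∩ Δ ⇒` the dual arms are joined through `Q_j*`".

## References

* O. Schramm, S. Smirnov (appendix by C. Garban), Ann. Probab. 39 (2011), Appendix B, proof of
  Lemma B.1 (the two displays before (B.6)) [SchrammSmirnov2011].
* H. Kesten, *Percolation theory for mathematicians* (1982), §2.2–2.3 (circuits meet crossings)
  [KestenPTM1982].

Tree: `openCircuitInAnnulus`, `siteSphere`, `sqAnnulus` (`FourArmGarban.lean`),
`exists_mem_support_inter_of_enclosesOrigin`, `mem_sqAnnulus_iff`, `mem_siteSphere_iff`
(`FourArmGarbanProofs.lean`), `exists_prefix_exit` (`FourArmGarbanTwoArms.lean`),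
`openCircuitInAnnulusAt_zero`, `dualCircuitInAnnulusAt` (`FourArmGarbanCircuitBits.lean`),
`mem_openConnIn_of_walk`, `mem_openConnIn_of_mem_support`, `openConnIn_comm`,
`PlanarDuality.openConnIn_trans` (`PlanarDuality.lean`), `box_mono`, `mem_box`.
-/

noncomputable section

namespace Literature.Probability.Percolation

open _root_.MeasureTheory Set LatticeModels

/-! ### An inward walk crosses the annulus along itself -/

/-- A neighbour of a site of `B(k)` lies in `B(k+1)` (`d = 2`). [folklore] -/
private theorem mem_box_succ_of_adj_two' {k : ℕ} {x z : Site 2} (hx : x ∈ box 2 k)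
    (h : (zdGraph 2).Adj x z) : z ∈ box 2 (k + 1) := by
  rw [mem_box] at hx ⊢
  obtain ⟨j, hj | hj⟩ := (zdGraph_adj_iff x z).1 h
  · intro i
    have h2 := hx i
    have h3 : z i = x i + (Pi.single j (1 : ℤ) : Site 2) i := by rw [hj]; rfl
    rw [Pi.single_apply] at h3
    push_cast
    split_ifs at h3 <;> omega
  · intro i
    have h2 := hx i
    have h3 : x i = z i + (Pi.single j (1 : ℤ) : Site 2) i := by rw [hj]; rfl
    rw [Pi.single_apply] at h3
    push_cast
    split_ifs at h3 <;> omega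

/-- **An inward walk crosses the annulus along itself.** A lattice walk from a site `z ∉ B(b')`
to a site `u ∈ B(a'-1)` (`1 ≤ a' ≤ b'`) contains a segment inside `A_{a',b'}` from a site of the
sphere `‖·‖_∞ = a'` to a site of the sphere `‖·‖_∞ = b'`, with vertices and edges among those of
the walk. [folklore] -/
theorem exists_crossing_subwalk {a' b' : ℕ} (ha : 1 ≤ a') (hab : a' ≤ b') {z u : Site 2}
    (P : (zdGraph 2).Walk z u) (hz : z ∉ box 2 b') (hu : u ∈ box 2 (a' - 1)) :
    ∃ (x y : Site 2) (q : (zdGraph 2).Walk x y), x ∈ siteSphere a' ∧ y ∈ siteSphere b' ∧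
      (∀ v ∈ q.support, v ∈ sqAnnulus a' b') ∧ (∀ v ∈ q.support, v ∈ P.support) ∧
      ∀ e ∈ q.edges, e ∈ P.edges := by
  -- Step 1: the initial segment of `P` outside `B(a'-1)`, ending on the sphere `a'`
  have hzA : z ∈ ({v | v ∉ box 2 (a' - 1)} : Set (Site 2)) := fun h =>
    hz (box_mono 2 (by omega) h)
  have huA : u ∉ ({v | v ∉ box 2 (a' - 1)} : Set (Site 2)) := fun h => h hu
  obtain ⟨x, w, q₁, hxw, hw, hA₁, hS₁, hE₁, -⟩ := exists_prefix_exit (A := {v | v ∉ box 2 (a' - 1)}) P hzA huA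
  have hwbox : w ∈ box 2 (a' - 1) := not_not.1 hw
  have hxa : x ∈ box 2 a' := by
    have := mem_box_succ_of_adj_two' hwbox hxw.symm
    rwa [Nat.sub_add_cancel ha] at this
  have hxs : x ∈ siteSphere a' := Finset.mem_sdiff.2 ⟨hxa, hA₁ x q₁.end_mem_support⟩
  -- Step 2: on the reversed segment `x ⟶ z`, the initial piece inside `B(b')`, ending on the sphere `b'`
  have hxB : x ∈ (↑(box 2 b') : Set (Site 2)) := Finset.mem_coe.2 (box_mono 2 hab hxa)
  have hzB : z ∉ (↑(box 2 b') : Set (Site 2)) := fun h => hz (Finset.mem_coe.1 h)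
  obtain ⟨y, w', q₂, hyw', hw', hA₂, hS₂, hE₂, -⟩ := exists_prefix_exit (A := (↑(box 2 b') : Set (Site 2))) q₁.reverse hxB hzB
  have hybox : y ∈ box 2 b' := Finset.mem_coe.1 (hA₂ y q₂.end_mem_support)
  have hw'out : w' ∉ box 2 b' := fun h => hw' (Finset.mem_coe.2 h)
  have hys : y ∈ siteSphere b' := by
    refine Finset.mem_sdiff.2 ⟨hybox, fun hyb => hw'out ?_⟩
    have := mem_box_succ_of_adj_two' hyb hyw'
    rcases Nat.eq_zero_or_pos b' with hb0 | hb0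
    · omega
    · rwa [Nat.sub_add_cancel hb0] at this
  refine ⟨x, y, q₂, hxs, hys, fun v hv => ?_, fun v hv => ?_, fun e he => ?_⟩
  · -- vertices of `q₂` lie in `B(b')` and (being vertices of `q₁`) outside `B(a'-1)`
    have hv1 : v ∈ q₁.support := by
      have := hS₂ v hv
      rwa [SimpleGraph.Walk.support_reverse, List.mem_reverse] at this
    simp only [sqAnnulus, Finset.mem_coe, mem_annulus]
    exact ⟨Finset.mem_coe.1 (hA₂ v hv), hA₁ v hv1⟩
  · have hv1 : v ∈ q₁.support := by
      have := hS₂ v hv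
      rwa [SimpleGraph.Walk.support_reverse, List.mem_reverse] at this
    exact hS₁ v hv1
  · have he1 : e ∈ q₁.edges := by
      have := hE₂ e he
      rwa [SimpleGraph.Walk.edges_reverse, List.mem_reverse] at this
    exact hE₁ e he1

/-! ### Two inward open walks and an open circuit give a connection -/

/-- **Docking to an open circuit** (the deterministic half of Garban's
"`P[X = 1 | C_j = 1, Q_j pivotal] > 5/8`"). Let `1 ≤ a' ≤ b' ≤ ρ`, let the lattice configuration `ω`
contain an open circuit of `A_{a',b'}` around the origin, and let `P₁ : z₁ ⟶ u₁`, `P₂ : z₂ ⟶ u₂` be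
`ω`-open walks inside `B(ρ)` from sites `zᵢ ∉ B(b')` to sites `uᵢ ∈ B(a'-1)`. Then `z₁` and `z₂`
are joined by an open path of `B(ρ)`: each `Pᵢ` crosses the annulus, the circuit meets both
crossings, and joins the two meeting points. [cite: SchrammSmirnov2011, Appendix B, proof of Lemma B.1 (the display before (B.6))] -/
theorem openConnIn_box_of_inward_walks_of_openCircuitInAnnulus {a' b' ρ : ℕ} (ha : 1 ≤ a')
    (hab : a' ≤ b') (hbρ : b' ≤ ρ) {ω : BondConfig (Site 2)} (hO : ω ∈ openCircuitInAnnulus a' b')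
    {z₁ u₁ z₂ u₂ : Site 2} (P₁ : (zdGraph 2).Walk z₁ u₁) (P₂ : (zdGraph 2).Walk z₂ u₂)
    (hP₁o : ∀ e ∈ P₁.edges, e ∈ ω) (hP₂o : ∀ e ∈ P₂.edges, e ∈ ω)
    (hP₁s : ∀ v ∈ P₁.support, v ∈ box 2 ρ) (hP₂s : ∀ v ∈ P₂.support, v ∈ box 2 ρ)
    (hz₁ : z₁ ∉ box 2 b') (hz₂ : z₂ ∉ box 2 b') (hu₁ : u₁ ∈ box 2 (a' - 1)) (hu₂ : u₂ ∈ box 2 (a' - 1)) :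
    ω ∈ openConnIn (↑(box 2 ρ) : Set (Site 2)) z₁ z₂ := by
  classical
  obtain ⟨v₀, C, -, hCs, hCo, hCe⟩ := hO
  -- the two crossings of the annulus along `P₁`, `P₂`
  obtain ⟨x₁, y₁, q₁, hx₁, hy₁, hq₁A, hq₁S, hq₁E⟩ := exists_crossing_subwalk ha hab P₁ hz₁ hu₁
  obtain ⟨x₂, y₂, q₂, hx₂, hy₂, hq₂A, hq₂S, hq₂E⟩ := exists_crossing_subwalk ha hab P₂ hz₂ hu₂
  -- the circuit meets both
  obtain ⟨w₁, hw₁q, hw₁C⟩ := exists_mem_support_inter_of_enclosesOrigin ha hCs hCe hx₁ hy₁ q₁ hq₁A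
  obtain ⟨w₂, hw₂q, hw₂C⟩ := exists_mem_support_inter_of_enclosesOrigin ha hCs hCe hx₂ hy₂ q₂ hq₂A
  -- `zᵢ ↔ wᵢ` along `Pᵢ` inside `B(ρ)`
  have hboxρ : ∀ v : Site 2, v ∈ box 2 ρ → v ∈ (↑(box 2 ρ) : Set (Site 2)) := fun v hv => Finset.mem_coe.2 hv
  have e₁ : ω ∈ openConnIn (↑(box 2 ρ) : Set (Site 2)) z₁ w₁ :=
    mem_openConnIn_of_mem_support P₁ (fun v hv => hboxρ v (hP₁s v hv)) hP₁o (hq₁S w₁ hw₁q)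
  have e₂ : ω ∈ openConnIn (↑(box 2 ρ) : Set (Site 2)) z₂ w₂ :=
    mem_openConnIn_of_mem_support P₂ (fun v hv => hboxρ v (hP₂s v hv)) hP₂o (hq₂S w₂ hw₂q)
  -- `w₁ ↔ w₂` along the circuit inside `B(b') ⊆ B(ρ)`
  have hCρ : ∀ v ∈ C.support, v ∈ (↑(box 2 ρ) : Set (Site 2)) := fun v hv => by
    have := hCs v hv
    simp only [sqAnnulus, Finset.mem_coe, mem_annulus] at this
    exact hboxρ v (box_mono 2 hbρ this.1)
  have f₁ : ω ∈ openConnIn (↑(box 2 ρ) : Set (Site 2)) v₀ w₁ := mem_openConnIn_of_mem_support C hCρ hCo hw₁C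
  have f₂ : ω ∈ openConnIn (↑(box 2 ρ) : Set (Site 2)) v₀ w₂ := mem_openConnIn_of_mem_support C hCρ hCo hw₂C
  rw [openConnIn_comm] at f₁ e₂
  exact PlanarDuality.openConnIn_trans (PlanarDuality.openConnIn_trans e₁ f₁)
    (PlanarDuality.openConnIn_trans f₂ e₂)

/-- **Docking to a closed dual circuit** (the deterministic half of the estimate "conditioned on
`{C_j = -1}`"): the same statement for the configuration `dualConfig ω` — walks of dual vertices
through dual edges crossing closed edges of `ω`, and the event `Δ = dualCircuitInAnnulusAt 0 a' b'`
of Garban's bit. [cite: SchrammSmirnov2011, Appendix B, proof of Lemma B.1 ("the opposite bound for the term conditioned on C_j = -1")] -/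
theorem openConnIn_box_of_inward_walks_of_dualCircuitInAnnulus {a' b' ρ : ℕ} (ha : 1 ≤ a')
    (hab : a' ≤ b') (hbρ : b' ≤ ρ) {ω : BondConfig (Site 2)} (hD : ω ∈ dualCircuitInAnnulusAt 0 a' b')
    {z₁ u₁ z₂ u₂ : Site 2} (P₁ : (zdGraph 2).Walk z₁ u₁) (P₂ : (zdGraph 2).Walk z₂ u₂)
    (hP₁o : ∀ e ∈ P₁.edges, e ∈ dualConfig ω) (hP₂o : ∀ e ∈ P₂.edges, e ∈ dualConfig ω)
    (hP₁s : ∀ v ∈ P₁.support, v ∈ box 2 ρ) (hP₂s : ∀ v ∈ P₂.support, v ∈ box 2 ρ)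
    (hz₁ : z₁ ∉ box 2 b') (hz₂ : z₂ ∉ box 2 b') (hu₁ : u₁ ∈ box 2 (a' - 1)) (hu₂ : u₂ ∈ box 2 (a' - 1)) :
    dualConfig ω ∈ openConnIn (↑(box 2 ρ) : Set (Site 2)) z₁ z₂ := by
  have hO : dualConfig ω ∈ openCircuitInAnnulus a' b' := by
    rwa [dualCircuitInAnnulusAt, Set.mem_preimage, openCircuitInAnnulusAt_zero] at hD
  exact openConnIn_box_of_inward_walks_of_openCircuitInAnnulus ha hab hbρ hO P₁ P₂ hP₁o hP₂o hP₁s hP₂s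
    hz₁ hz₂ hu₁ hu₂

/-! ### Recentred form (squares `Q_j = c + B(ρ)`) -/

/-- Transport of an open walk by a translation: the translated walk is open in the translated
configuration. [folklore] -/
theorem forall_edges_map_shift_mem_relabel {v : Site 2} {ω : BondConfig (Site 2)} {z u : Site 2}
    (P : (zdGraph 2).Walk z u) (hP : ∀ e ∈ P.edges, e ∈ ω) :
    ∀ e ∈ (P.map (zdShiftIso v).toHom).edges, e ∈ BondConfig.relabel (sym2Equiv (Site.shift v)) ω := by
  intro e he
  rw [SimpleGraph.Walk.edges_map, List.mem_map] at he
  obtain ⟨e₀, he₀, rfl⟩ := he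
  show Sym2.map (Site.shift v) e₀ ∈ _
  rw [BondConfig.mem_relabel_iff, sym2Equiv_symm, sym2Equiv_apply, Sym2.map_map,
    Equiv.symm_comp_self, Sym2.map_id, id]
  exact hP e₀ he₀

/-- **Docking to an open circuit, around an arbitrary centre `c`**: if `ω` has an open circuit of
`c + A_{a',b'}` around `c` (`openCircuitInAnnulusAt c a' b'`, the event `O` of Garban's bit of the
square at `c`) and `ω`-open walks `Pᵢ : zᵢ ⟶ uᵢ` inside `c + B(ρ)` from `zᵢ ∉ c + B(b')` to
`uᵢ ∈ c + B(a'-1)` (`1 ≤ a' ≤ b' ≤ ρ`), then `z₁ ↔ z₂` by an open path of `c + B(ρ)`.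
(Translation of `openConnIn_box_of_inward_walks_of_openCircuitInAnnulus`.) [cite: SchrammSmirnov2011, Appendix B, proof of Lemma B.1 (the display before (B.6))] -/
theorem openConnIn_shift_box_of_inward_walks_of_openCircuitInAnnulusAt {c : Site 2} {a' b' ρ : ℕ}
    (ha : 1 ≤ a') (hab : a' ≤ b') (hbρ : b' ≤ ρ) {ω : BondConfig (Site 2)}
    (hO : ω ∈ openCircuitInAnnulusAt c a' b')
    {z₁ u₁ z₂ u₂ : Site 2} (P₁ : (zdGraph 2).Walk z₁ u₁) (P₂ : (zdGraph 2).Walk z₂ u₂)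
    (hP₁o : ∀ e ∈ P₁.edges, e ∈ ω) (hP₂o : ∀ e ∈ P₂.edges, e ∈ ω)
    (hP₁s : ∀ v ∈ P₁.support, v - c ∈ box 2 ρ) (hP₂s : ∀ v ∈ P₂.support, v - c ∈ box 2 ρ)
    (hz₁ : z₁ - c ∉ box 2 b') (hz₂ : z₂ - c ∉ box 2 b')
    (hu₁ : u₁ - c ∈ box 2 (a' - 1)) (hu₂ : u₂ - c ∈ box 2 (a' - 1)) :
    ω ∈ openConnIn ((· + c) '' (↑(box 2 ρ) : Set (Site 2))) z₁ z₂ := by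
  -- translate everything by `-c`
  set ω' : BondConfig (Site 2) := BondConfig.relabel (sym2Equiv (Site.shift (-c))) ω with hω'
  have hO' : ω' ∈ openCircuitInAnnulus a' b' := by
    have := relabel_shift_mem_openCircuitInAnnulusAt (v := -c) hO
    rwa [add_neg_cancel, openCircuitInAnnulusAt_zero] at this
  have hshift : ∀ x : Site 2, (zdShiftIso (-c)).toHom x = x - c := fun x => by
    show x + -c = x - c
    rw [sub_eq_add_neg]
  set P₁' := P₁.map (zdShiftIso (-c)).toHom with hP₁'
  set P₂' := P₂.map (zdShiftIso (-c)).toHom with hP₂'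
  have hsupp : ∀ {z u : Site 2} (P : (zdGraph 2).Walk z u), (∀ v ∈ P.support, v - c ∈ box 2 ρ) →
      ∀ v ∈ (P.map (zdShiftIso (-c)).toHom).support, v ∈ box 2 ρ := by
    intro z u P hP v hv
    rw [SimpleGraph.Walk.support_map, List.mem_map] at hv
    obtain ⟨w, hw, rfl⟩ := hv
    rw [hshift]
    exact hP w hw
  have h' : ω' ∈ openConnIn (↑(box 2 ρ) : Set (Site 2)) ((zdShiftIso (-c)).toHom z₁)
      ((zdShiftIso (-c)).toHom z₂) :=
    openConnIn_box_of_inward_walks_of_openCircuitInAnnulus ha hab hbρ hO' P₁' P₂'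
      (forall_edges_map_shift_mem_relabel P₁ hP₁o) (forall_edges_map_shift_mem_relabel P₂ hP₂o)
      (hsupp P₁ hP₁s) (hsupp P₂ hP₂s) (by rw [hshift]; exact hz₁) (by rw [hshift]; exact hz₂)
      (by rw [hshift]; exact hu₁) (by rw [hshift]; exact hu₂)
  -- translate back by `c`
  have hback := relabel_mem_openConnIn (Site.shift c) h'
  have hωback : BondConfig.relabel (sym2Equiv (Site.shift c)) ω' = ω := by
    simpa [hω'] using relabel_shift_neg_relabel_shift (-c) ω
  have hpt : ∀ x : Site 2, Site.shift c ((zdShiftIso (-c)).toHom x) = x := fun x => by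
    rw [hshift, Site.shift_apply, sub_add_cancel]
  have himg : (Site.shift c) '' (↑(box 2 ρ) : Set (Site 2)) = (· + c) '' (↑(box 2 ρ) : Set (Site 2)) := by
    refine congrArg (fun f => f '' (↑(box 2 ρ) : Set (Site 2))) (funext fun x => ?_)
    exact Site.shift_apply c x
  rwa [hωback, hpt, hpt, himg] at hback

/-- **Docking to a closed dual circuit, around an arbitrary centre** (`dualCircuitInAnnulusAt c`,
the event `Δ` of Garban's bit; walks open in `dualConfig ω`). [cite: SchrammSmirnov2011, Appendix B, proof of Lemma B.1 ("the opposite bound for the term conditioned on C_j = -1")] -/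
theorem openConnIn_shift_box_of_inward_walks_of_dualCircuitInAnnulusAt {c : Site 2} {a' b' ρ : ℕ}
    (ha : 1 ≤ a') (hab : a' ≤ b') (hbρ : b' ≤ ρ) {ω : BondConfig (Site 2)}
    (hD : ω ∈ dualCircuitInAnnulusAt c a' b')
    {z₁ u₁ z₂ u₂ : Site 2} (P₁ : (zdGraph 2).Walk z₁ u₁) (P₂ : (zdGraph 2).Walk z₂ u₂)
    (hP₁o : ∀ e ∈ P₁.edges, e ∈ dualConfig ω) (hP₂o : ∀ e ∈ P₂.edges, e ∈ dualConfig ω)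
    (hP₁s : ∀ v ∈ P₁.support, v - c ∈ box 2 ρ) (hP₂s : ∀ v ∈ P₂.support, v - c ∈ box 2 ρ)
    (hz₁ : z₁ - c ∉ box 2 b') (hz₂ : z₂ - c ∉ box 2 b')
    (hu₁ : u₁ - c ∈ box 2 (a' - 1)) (hu₂ : u₂ - c ∈ box 2 (a' - 1)) :
    dualConfig ω ∈ openConnIn ((· + c) '' (↑(box 2 ρ) : Set (Site 2))) z₁ z₂ :=
  openConnIn_shift_box_of_inward_walks_of_openCircuitInAnnulusAt ha hab hbρ
    (by rwa [dualCircuitInAnnulusAt, Set.mem_preimage] at hD) P₁ P₂ hP₁o hP₂o hP₁s hP₂s hz₁ hz₂ hu₁ hu₂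

end Literature.Probability.Percolation
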